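import Summits.HodgeConjecture.HodgeConjecture.Theorems.H413CohFormsCarriers

/-!
# `Cruxes/H413/Lines/CohFormsCarriers.lean` — EDITION v2: RE-EXPORT SHELL (0 declarations)

The shared FLOOR-0 P2∕P4 carriers (`adelicDatum`, `finToAdelic`, `archToAdelic'`, `ArchFactor`, `ArchFactor.IsHonest`, `rightRep`,
`smoothFun`, `conjFun`, `holCotForms`, `cohForms`, and §3 the factor of record `archFactorOf F V` with its `rfl` lemmas) now live in the
BUILT tree module `Summits/HodgeConjecture/HodgeConjecture/Theorems/H413CohFormsCarriers.lean` (★ p787557, commit 4710ae795606,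
A-p13 (g21); namespace `Summit.HodgeConjecture.HodgeConjecture.Cruxes.H413.CohFormsCarriers` unchanged), which the registered lines
`Lines/P4AdmissibleOccursInH1.lean` (v2.1, commit 12c0cc8eb24b) and `Lines/P2ThetaDictionaryExists.lean` (v3, commit 1e9d48415954) import.

Edition v1 of this workfile (efb3094ce22351d9, commit accd50068376, 2026-08-30 19:12Z) carried the same declarations in the same namespace;
it is replaced by this shell so that no import closure can ever see two copies of the carriers (one currency only: the Theorems module's).
Importing this file = importing the Theorems module. Registrar: A-plan1 (g17), 2026-08-30 ≈21:00Z; no `ledger skeleton check` (s320 (3)∕s335).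
HC_CM is proved only modulo the 7 printed citations until rung 0 closes.
-/
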